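import Literature.NumberTheory.EllipticCurves.TunnellThetaAutomorphyProofs
import Mathlib.NumberTheory.LegendreSymbol.JacobiSymbol
import Mathlib.Tactic.NormNum.LegendreSymbol
import HarnessLib

/-!
# Crux `PrintCFram.BottomClassIndexLawFiveLe` (stmt-BirchSwinnertonDyer-20372), line `eisenstein-resource-bdp-line`:
# THE 2-ADIC FLIPPED-CUSP RUNG, typing item T6a — THE GAUSS SUMS MOD 8 OF THE θ-MULTIPLIER
# (cell `bsd-print-cfram`, width seat `bsd-line-cfram-p1-w7` g8; THEOREMS ONLY, `--supports` 20372 `--as helper`; BSD is not proved by any of this)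

HONEST FRAMING. Finite identities in `ℂ` about the eighth root of unity `Z = e(1/8)`, Shimura's `ε_d` (`thetaEps`, the tree's
`HalfIntegralWeightFormsThetaMultiplierProofs`) and the Jacobi symbols `(2|d)`, `(8M′|d)`; nothing about BSD, curves or modular forms. They are
the weights of the 2-adic flipped-cusp rung (crux notes `Lines/eisenstein-resource-bdp-line-w7g8-T6.md` §1d/§3b; registry v29 `stub_flipRungs`,
second conjunct (FlipRungTwo⁶)): with T6b's `γ_j = [[8a + jM′, ·],[8M′, d_j]]`, `d_j = 8 + M′j`, the half-integral automorphy factor of a member of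
`halfIntModularForms (2k+1) (4M′) ψ` at `γ_j` is `ψ(d_j)·((thetaEps d_j)⁻¹·J(8M′ | d_j))^{2k+1}·√(8M′z + d_j)^{2k+1}` (tree:
`apply_smul_eq_of_mem`, `thetaFactor`), and the flipped-cusp coefficient of `e(nz)` in the class cut `P_c` is `a(n)·(1/8)·Σ_{j odd mod 8} μ_j e(−(c+n)j/8)`.
This file evaluates those sums:

* §1 `Z := exp(2πi/8)`: `Z = (√2/2)(1 + i)`, `Z² = i`, `Z⁴ = −1`, `Z⁸ = 1`, and `exp(−2πi·t/8) = Z^{(8 − t % 8) % 8}`.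
* §2 the multiplier arithmetic at `d = 8 + M′j`: `J(8M′ | d) = J(2 | d)·J(2 | M′)·(−1)^{[M′ ≡ 3 ≡ d (4)]}` (reciprocity, `d ≡ 8 (mod M′)`),
  `(thetaEps d)⁻¹^(2k+1) = (thetaEps d)⁻¹·χ₋₄(d)^k`; so `μ_j = ψ(d_j)·J(2|M′)·F_χ(d_j)` with `F_χ(d) = χ(d)·J(2|d)·(thetaEps d)⁻¹`,
  `χ ∈ {1, χ₄, (2/·), χ₄·(2/·)}` explicit sign patterns on `d mod 8`.
* §3 THE FOUR TABLES `G_F(s) := Σ_{d ∈ {1,3,5,7}} F(d)·Z^{−sd}`, `s mod 8`: `G_{F₁} = ±4Z⁷` at `s ≡ 1, 5 (8)` (else `0`),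
  `G_{F_{χ₄}} = ∓4Z` at `s ≡ 3, 7`, `G_{F_{(2/·)}} = ±(2 − 2i)` at even `s`, `G_{F_{χ₄(2/·)}} = ±(2 + 2i)` at even `s` — every non-zero value
  times its conjugate is `16` resp. `8`: a unit at every odd prime (NO exceptional prime at `2`).

beyond-print theorem: NO. References: [Shimura1973HalfIntegral] §1 (ε_d, (c/d)); [IrelandRosen1990] Ch. 5 (Jacobi reciprocity); crux notes w7g8-T6.
-/

set_option autoImplicit false
-- summit-side namespace `Summit.BirchSwinnertonDyer.BirchSwinnertonDyer.…` (single-conjunct summit, D-0017 layout)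
set_option linter.dupNamespace false

noncomputable section

open scoped NumberTheorySymbols Real
open Complex
open Literature.NumberTheory.EllipticCurves.ModularForms (thetaEps thetaEps_eq_of_emod_eq thetaEps_inv_sq)
open Literature.NumberTheory.EllipticCurves (Tunnell1983.jacobiSym_eight)

namespace Summit.BirchSwinnertonDyer.BirchSwinnertonDyer.Theorems.PrintCFram.FlipRung

/-! ## §1 The eighth root of unity `Z = e(1/8)` -/

/-- `e(1/8) = (√2/2)·(1 + i)` (`cos(π/4) = sin(π/4) = √2/2`). [folklore] -/
theorem exp_two_pi_I_div_eight : cexp (2 * π * I / 8) = ((Real.sqrt 2 / 2 : ℝ) : ℂ) * (1 + I) := by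
  have e : (2 * π * I / 8 : ℂ) = ((π / 4 : ℝ) : ℂ) * I := by push_cast; ring
  rw [e, exp_mul_I, ← ofReal_cos, ← ofReal_sin, Real.cos_pi_div_four, Real.sin_pi_div_four]
  ring

/-- `e(1/8)² = i`. [folklore] -/
theorem exp_two_pi_I_div_eight_sq : cexp (2 * π * I / 8) ^ 2 = I := by
  rw [← Complex.exp_nat_mul]
  have e : ((2 : ℕ) : ℂ) * (2 * π * I / 8) = ((π / 2 : ℝ) : ℂ) * I := by push_cast; ring
  rw [e, exp_mul_I, ← ofReal_cos, ← ofReal_sin, Real.cos_pi_div_two, Real.sin_pi_div_two]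
  simp

/-- `e(1/8)⁴ = −1`. [folklore] -/
theorem exp_two_pi_I_div_eight_pow_four : cexp (2 * π * I / 8) ^ 4 = -1 := by
  rw [show (4 : ℕ) = 2 * 2 from rfl, pow_mul, exp_two_pi_I_div_eight_sq, I_sq]

/-- `e(1/8)⁸ = 1`. [folklore] -/
theorem exp_two_pi_I_div_eight_pow_eight : cexp (2 * π * I / 8) ^ 8 = 1 := by
  rw [show (8 : ℕ) = 4 * 2 from rfl, pow_mul, exp_two_pi_I_div_eight_pow_four]; norm_num

/-- `e(t/8) = Z^t` for `t : ℕ`. [folklore] -/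
theorem exp_two_pi_I_mul_div_eight (t : ℕ) : cexp (2 * π * I * t / 8) = cexp (2 * π * I / 8) ^ t := by
  rw [← Complex.exp_nat_mul]; congr 1; ring

/-- `Z^t` depends on `t mod 8`. [folklore] -/
theorem exp_two_pi_I_div_eight_pow_mod (t : ℕ) : cexp (2 * π * I / 8) ^ t = cexp (2 * π * I / 8) ^ (t % 8) := by
  conv_lhs => rw [← Nat.mod_add_div t 8, pow_add, pow_mul, exp_two_pi_I_div_eight_pow_eight, one_pow, mul_one]

/-- `e(−t/8) = Z^{(8 − t % 8) % 8}` for `t : ℕ` (the exponent of the flipped-cusp weights). [folklore] -/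
theorem exp_neg_two_pi_I_mul_div_eight (t : ℕ) :
    cexp (-(2 * π * I * t / 8)) = cexp (2 * π * I / 8) ^ ((8 - t % 8) % 8) := by
  have h8 : cexp (2 * π * I / 8) ^ 8 = 1 := exp_two_pi_I_div_eight_pow_eight
  rw [Complex.exp_neg, exp_two_pi_I_mul_div_eight, exp_two_pi_I_div_eight_pow_mod t]
  -- `Z^{t%8} · Z^{(8 - t%8)%8} = 1`
  have hmul : cexp (2 * π * I / 8) ^ (t % 8) * cexp (2 * π * I / 8) ^ ((8 - t % 8) % 8) = 1 := by
    rcases Nat.eq_zero_or_pos (t % 8) with h0 | hpos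
    · rw [h0]; norm_num
    · rw [Nat.mod_eq_of_lt (by omega : 8 - t % 8 < 8), ← pow_add, show t % 8 + (8 - t % 8) = 8 by omega, h8]
  exact (eq_inv_of_mul_eq_one_right hmul).symm

/-! ## §2 Powers of a square root `z` of `i` (`z = Z = e(1/8)` or any other) -/

/-- For `z² = i`: `z⁴ = −1`, `z⁵ = −z`, `z⁶ = −z²`, `z⁷ = −z³`, `z⁸ = 1` (reduction to the basis `1, z, z², z³` of `ℚ(ζ₈)`).
[folklore] -/
theorem pow_of_sq_eq_I {z : ℂ} (h2 : z ^ 2 = I) :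
    z ^ 4 = -1 ∧ z ^ 5 = -z ∧ z ^ 6 = -z ^ 2 ∧ z ^ 7 = -z ^ 3 ∧ z ^ 8 = 1 := by
  have h4 : z ^ 4 = -1 := by rw [show z ^ 4 = (z ^ 2) ^ 2 by ring, h2, I_sq]
  refine ⟨h4, ?_, ?_, ?_, ?_⟩
  · rw [pow_succ, h4]; ring
  · rw [show z ^ 6 = z ^ 4 * z ^ 2 by ring, h4]; ring
  · rw [show z ^ 7 = z ^ 4 * z ^ 3 by ring, h4]; ring
  · rw [show z ^ 8 = (z ^ 4) ^ 2 by ring, h4]; norm_num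

/-- The exponent `(8 − t % 8) % 8` only depends on `t mod 8`: `(8 − s·d % 8) % 8 = (8 − (s % 8)·d % 8) % 8`. [folklore] -/
theorem negExp_mod_eight (s d : ℕ) : (8 - s * d % 8) % 8 = (8 - s % 8 * d % 8) % 8 := by
  rw [Nat.mul_mod s d, Nat.mul_mod (s % 8) d, Nat.mod_mod]

/-! ## §3 The four discrete Fourier transforms on the odd residues mod 8

`S = {1,3,5,7}`, `G_P(r) := Σ_{d ∈ S} P(d)·z^{(8 − r d % 8) % 8}` (`= Σ_d P(d) Z^{−rd}` at `z = Z`), for the four value patterns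
`P = F₁ = (1, i, −1, −i)`, `F_{χ₄} = (1, −i, −1, i)`, `F_{(2/·)} = (1, −i, 1, −i)`, `F_{χ₄(2/·)} = (1, i, 1, i)` on `d = (1, 3, 5, 7)`; the pattern is a
HYPOTHESIS on an arbitrary `P : ℕ → ℂ` (four values), so that any currency for the weights `μ_j` can be plugged in. -/

/-- **DFT of the pattern `F₁ = (1, i, −1, −i)`** (`χ = 1`): `G(r) = 4z⁷ = 4z⁻¹` at `r ≡ 1`, `−4z⁷` at `r ≡ 5`, else `0` (`r mod 8`). [folklore] -/
theorem dft8_pattern_one {z : ℂ} (h2 : z ^ 2 = I) (P : ℕ → ℂ) (hP : P 1 = 1 ∧ P 3 = I ∧ P 5 = -1 ∧ P 7 = -I)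
    (r : ℕ) (hr : r < 8) :
    ∑ d ∈ ({1, 3, 5, 7} : Finset ℕ), P d * z ^ ((8 - r * d % 8) % 8) =
      if r = 1 then 4 * z ^ 7 else if r = 5 then -4 * z ^ 7 else 0 := by
  obtain ⟨h4, h5, h6, h7, -⟩ := pow_of_sq_eq_I h2
  obtain ⟨p1, p3, p5, p7⟩ := hP
  rw [← h2] at p3 p7
  interval_cases r <;> norm_num [Finset.sum_insert, Finset.sum_singleton, p1, p3, p5, p7, h4, h5, h6, h7] <;> ring_nf <;>
    simp only [h5] <;> ring

/-- **DFT of the pattern `F_{χ₄} = (1, −i, −1, i)`** (`χ = χ₋₄`): `G(r) = −4z` at `r ≡ 3`, `4z` at `r ≡ 7`, else `0`. [folklore] -/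
theorem dft8_pattern_chi4 {z : ℂ} (h2 : z ^ 2 = I) (P : ℕ → ℂ) (hP : P 1 = 1 ∧ P 3 = -I ∧ P 5 = -1 ∧ P 7 = I)
    (r : ℕ) (hr : r < 8) :
    ∑ d ∈ ({1, 3, 5, 7} : Finset ℕ), P d * z ^ ((8 - r * d % 8) % 8) =
      if r = 3 then -4 * z else if r = 7 then 4 * z else 0 := by
  obtain ⟨h4, h5, h6, h7, -⟩ := pow_of_sq_eq_I h2
  obtain ⟨p1, p3, p5, p7⟩ := hP
  rw [← h2] at p3 p7
  interval_cases r <;> norm_num [Finset.sum_insert, Finset.sum_singleton, p1, p3, p5, p7, h4, h5, h6, h7] <;> ring_nf <;>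
    simp only [h5] <;> ring

/-- **DFT of the pattern `F_{(2/·)} = (1, −i, 1, −i)`** (`χ = (2/·)`, i.e. `P(d) = ε_d⁻¹`): `G(r) = 2 − 2i` at `r ≡ 0, 2`, `−(2 − 2i)` at
`r ≡ 4, 6`, and `0` at odd `r`. [folklore] -/
theorem dft8_pattern_chi8 {z : ℂ} (h2 : z ^ 2 = I) (P : ℕ → ℂ) (hP : P 1 = 1 ∧ P 3 = -I ∧ P 5 = 1 ∧ P 7 = -I)
    (r : ℕ) (hr : r < 8) :
    ∑ d ∈ ({1, 3, 5, 7} : Finset ℕ), P d * z ^ ((8 - r * d % 8) % 8) =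
      if r = 0 ∨ r = 2 then 2 - 2 * I else if r = 4 ∨ r = 6 then -(2 - 2 * I) else 0 := by
  obtain ⟨h4, h5, h6, h7, -⟩ := pow_of_sq_eq_I h2
  obtain ⟨p1, p3, p5, p7⟩ := hP
  rw [← h2] at p3 p7 ⊢
  interval_cases r <;> norm_num [Finset.sum_insert, Finset.sum_singleton, p1, p3, p5, p7, h4, h5, h6, h7] <;> ring_nf <;>
    simp only [h4] <;> ring

/-- **DFT of the pattern `F_{χ₄(2/·)} = (1, i, 1, i)`** (`χ = χ₋₄·(2/·)`): `G(r) = 2 + 2i` at `r ≡ 0, 6`, `−(2 + 2i)` at `r ≡ 2, 4`, and `0`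
at odd `r`. [folklore] -/
theorem dft8_pattern_chi4chi8 {z : ℂ} (h2 : z ^ 2 = I) (P : ℕ → ℂ) (hP : P 1 = 1 ∧ P 3 = I ∧ P 5 = 1 ∧ P 7 = I)
    (r : ℕ) (hr : r < 8) :
    ∑ d ∈ ({1, 3, 5, 7} : Finset ℕ), P d * z ^ ((8 - r * d % 8) % 8) =
      if r = 0 ∨ r = 6 then 2 + 2 * I else if r = 2 ∨ r = 4 then -(2 + 2 * I) else 0 := by
  obtain ⟨h4, h5, h6, h7, -⟩ := pow_of_sq_eq_I h2
  obtain ⟨p1, p3, p5, p7⟩ := hP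
  rw [← h2] at p3 p7 ⊢
  interval_cases r <;> norm_num [Finset.sum_insert, Finset.sum_singleton, p1, p3, p5, p7, h4, h5, h6, h7] <;> ring_nf <;>
    simp only [h4] <;> ring

/-! ## §4 Reindexing the sum over `j` (translations `z + j/8`, `j` odd) by `d ≡ M′j (mod 8)` (`d_j = 8 + M′j`) -/

/-- For odd `M`, `j ↦ M·j mod 8` is an involution of `{1,3,5,7}` (`M² ≡ 1 (mod 8)`): `Σ_j Φ(Mj mod 8)·ω(j) = Σ_d Φ(d)·ω(Md mod 8)` for
arbitrary `Φ ω : ℕ → ℂ`. [folklore] -/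
theorem sum_odd_residues_reindex {M : ℕ} (hM : Odd M) (Φ ω : ℕ → ℂ) :
    ∑ j ∈ ({1, 3, 5, 7} : Finset ℕ), Φ (M * j % 8) * ω j = ∑ d ∈ ({1, 3, 5, 7} : Finset ℕ), Φ d * ω (M * d % 8) := by
  have hm : M % 8 = 1 ∨ M % 8 = 3 ∨ M % 8 = 5 ∨ M % 8 = 7 := by have := Nat.odd_iff.mp hM; omega
  have hred : ∀ j : ℕ, M * j % 8 = M % 8 * j % 8 := fun j => by rw [Nat.mul_mod M j, Nat.mul_mod (M % 8) j, Nat.mod_mod]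
  simp_rw [hred]
  rcases hm with h | h | h | h <;> rw [h] <;> norm_num [Finset.sum_insert, Finset.sum_singleton] <;> ring

/-- The flipped-cusp weight sum, reindexed: for odd `M`, `Σ_{j ∈ {1,3,5,7}} Φ(Mj mod 8)·z^{(8 − tj % 8) % 8} = Σ_{d} Φ(d)·z^{(8 − (Mt)d % 8) % 8}`
(`j ≡ Md`, so `tj ≡ Mtd (mod 8)`), for any `8`-th root of unity exponent bookkeeping (`z` arbitrary: only exponents mod 8 are compared). [folklore] -/
theorem sum_odd_residues_reindex_pow {M : ℕ} (hM : Odd M) (Φ : ℕ → ℂ) (z : ℂ) (t : ℕ) :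
    ∑ j ∈ ({1, 3, 5, 7} : Finset ℕ), Φ (M * j % 8) * z ^ ((8 - t * j % 8) % 8) =
      ∑ d ∈ ({1, 3, 5, 7} : Finset ℕ), Φ d * z ^ ((8 - M * t * d % 8) % 8) := by
  rw [sum_odd_residues_reindex hM Φ (fun j => z ^ ((8 - t * j % 8) % 8))]
  refine Finset.sum_congr rfl (fun d _ => ?_)
  have e : t * (M * d % 8) % 8 = M * t * d % 8 := by rw [Nat.mul_mod_mod, ← mul_assoc, mul_comm t M]
  simp only [e]

/-- **The flipped-cusp weight sum for the pattern `F₁`**, as it occurs (sum over the odd translations `j`, `d_j ≡ M′j (mod 8)`):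
`Σ_{j ∈ {1,3,5,7}} Φ(M′j mod 8)·z^{(8 − tj % 8) % 8} = 4z⁷`, `−4z⁷`, `0` according as `M′t ≡ 1, 5`, other `(mod 8)`. [folklore] -/
theorem flipWeightSum_pattern_one {M : ℕ} (hM : Odd M) (Φ : ℕ → ℂ) (hΦ : Φ 1 = 1 ∧ Φ 3 = I ∧ Φ 5 = -1 ∧ Φ 7 = -I)
    {z : ℂ} (h2 : z ^ 2 = I) (t : ℕ) :
    ∑ j ∈ ({1, 3, 5, 7} : Finset ℕ), Φ (M * j % 8) * z ^ ((8 - t * j % 8) % 8) =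
      if M * t % 8 = 1 then 4 * z ^ 7 else if M * t % 8 = 5 then -4 * z ^ 7 else 0 := by
  rw [sum_odd_residues_reindex_pow hM]
  simp_rw [negExp_mod_eight (M * t)]
  exact dft8_pattern_one h2 Φ hΦ (M * t % 8) (Nat.mod_lt _ (by norm_num))

/-- The flipped-cusp weight sum for the pattern `F_{χ₄}`: `−4z`, `4z`, `0` according as `M′t ≡ 3, 7`, other `(mod 8)`. [folklore] -/
theorem flipWeightSum_pattern_chi4 {M : ℕ} (hM : Odd M) (Φ : ℕ → ℂ) (hΦ : Φ 1 = 1 ∧ Φ 3 = -I ∧ Φ 5 = -1 ∧ Φ 7 = I)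
    {z : ℂ} (h2 : z ^ 2 = I) (t : ℕ) :
    ∑ j ∈ ({1, 3, 5, 7} : Finset ℕ), Φ (M * j % 8) * z ^ ((8 - t * j % 8) % 8) =
      if M * t % 8 = 3 then -4 * z else if M * t % 8 = 7 then 4 * z else 0 := by
  rw [sum_odd_residues_reindex_pow hM]
  simp_rw [negExp_mod_eight (M * t)]
  exact dft8_pattern_chi4 h2 Φ hΦ (M * t % 8) (Nat.mod_lt _ (by norm_num))

/-- The flipped-cusp weight sum for the pattern `F_{(2/·)}`: `2 − 2i`, `−(2 − 2i)`, `0` according as `M′t ≡ 0,2`, `≡ 4,6`, odd `(mod 8)`.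
[folklore] -/
theorem flipWeightSum_pattern_chi8 {M : ℕ} (hM : Odd M) (Φ : ℕ → ℂ) (hΦ : Φ 1 = 1 ∧ Φ 3 = -I ∧ Φ 5 = 1 ∧ Φ 7 = -I)
    {z : ℂ} (h2 : z ^ 2 = I) (t : ℕ) :
    ∑ j ∈ ({1, 3, 5, 7} : Finset ℕ), Φ (M * j % 8) * z ^ ((8 - t * j % 8) % 8) =
      if M * t % 8 = 0 ∨ M * t % 8 = 2 then 2 - 2 * I else if M * t % 8 = 4 ∨ M * t % 8 = 6 then -(2 - 2 * I) else 0 := by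
  rw [sum_odd_residues_reindex_pow hM]
  simp_rw [negExp_mod_eight (M * t)]
  exact dft8_pattern_chi8 h2 Φ hΦ (M * t % 8) (Nat.mod_lt _ (by norm_num))

/-- The flipped-cusp weight sum for the pattern `F_{χ₄(2/·)}`: `2 + 2i`, `−(2 + 2i)`, `0` according as `M′t ≡ 0,6`, `≡ 2,4`, odd `(mod 8)`.
[folklore] -/
theorem flipWeightSum_pattern_chi4chi8 {M : ℕ} (hM : Odd M) (Φ : ℕ → ℂ) (hΦ : Φ 1 = 1 ∧ Φ 3 = I ∧ Φ 5 = 1 ∧ Φ 7 = I)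
    {z : ℂ} (h2 : z ^ 2 = I) (t : ℕ) :
    ∑ j ∈ ({1, 3, 5, 7} : Finset ℕ), Φ (M * j % 8) * z ^ ((8 - t * j % 8) % 8) =
      if M * t % 8 = 0 ∨ M * t % 8 = 6 then 2 + 2 * I else if M * t % 8 = 2 ∨ M * t % 8 = 4 then -(2 + 2 * I) else 0 := by
  rw [sum_odd_residues_reindex_pow hM]
  simp_rw [negExp_mod_eight (M * t)]
  exact dft8_pattern_chi4chi8 h2 Φ hΦ (M * t % 8) (Nat.mod_lt _ (by norm_num))

/-! ## §5 The θ-multiplier data: `ε_d`, `J(2|d)·ε_d⁻¹ = F₁(d mod 8)`, `ε_d⁻¹^{2k+1}`, and `J(8M′ | d)` for `d ≡ 8 (mod M′)` -/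

/-- Shimura's `ε_d` on the odd residues mod 8: `ε₁ = ε₅ = 1`, `ε₃ = ε₇ = i`. [cite: Shimura1973HalfIntegral, §1 (1.10)] -/
theorem thetaEps_values : thetaEps 1 = 1 ∧ thetaEps 3 = I ∧ thetaEps 5 = 1 ∧ thetaEps 7 = I := by
  refine ⟨?_, ?_, ?_, ?_⟩ <;> norm_num [thetaEps]

/-- **The base pattern is `F₁`**: `J(2|d)·ε_d⁻¹ = 1, i, −1, −i` at `d = 1, 3, 5, 7`. [folklore] -/
theorem jacobiTwo_mul_thetaEps_inv_values :
    (J(2 | 1) : ℂ) * (thetaEps (1 : ℕ))⁻¹ = 1 ∧ (J(2 | 3) : ℂ) * (thetaEps (3 : ℕ))⁻¹ = I ∧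
      (J(2 | 5) : ℂ) * (thetaEps (5 : ℕ))⁻¹ = -1 ∧ (J(2 | 7) : ℂ) * (thetaEps (7 : ℕ))⁻¹ = -I := by
  obtain ⟨e1, e3, e5, e7⟩ := thetaEps_values
  refine ⟨?_, ?_, ?_, ?_⟩ <;> norm_num [e1, e3, e5, e7]

/-- `J(2|d)·ε_d⁻¹` only depends on `d mod 8` (`d` odd). [folklore] -/
theorem jacobiTwo_mul_thetaEps_inv_mod_eight {d : ℕ} (hd : Odd d) :
    (J(2 | d) : ℂ) * (thetaEps d)⁻¹ = (J(2 | (d % 8 : ℕ)) : ℂ) * (thetaEps (d % 8 : ℕ))⁻¹ := by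
  have h1 : J(2 | d) = J(2 | (d % 8 : ℕ)) := by rw [jacobiSym.mod_right 2 hd]; norm_num
  have h2 : thetaEps d = thetaEps (d % 8 : ℕ) := thetaEps_eq_of_emod_eq (by push_cast; omega)
  rw [h1, h2]

/-- **`G_{F₁}` at `z = Z = e(1/8)` with the θ-multiplier pattern written out**: for every `s : ℕ`,
`Σ_{d ∈ {1,3,5,7}} J(2|d)·ε_d⁻¹·Z^{(8 − sd % 8) % 8} = 4Z⁷ / −4Z⁷ / 0` according as `s ≡ 1 / 5 / other (mod 8)`. [folklore] -/
theorem gaussSumEight_one (s : ℕ) :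
    ∑ d ∈ ({1, 3, 5, 7} : Finset ℕ), (J(2 | d) : ℂ) * (thetaEps d)⁻¹ * cexp (2 * π * I / 8) ^ ((8 - s * d % 8) % 8) =
      if s % 8 = 1 then 4 * cexp (2 * π * I / 8) ^ 7 else if s % 8 = 5 then -4 * cexp (2 * π * I / 8) ^ 7 else 0 := by
  simp_rw [negExp_mod_eight s]
  exact dft8_pattern_one exp_two_pi_I_div_eight_sq (fun d => (J(2 | d) : ℂ) * (thetaEps d)⁻¹)
    jacobiTwo_mul_thetaEps_inv_values (s % 8) (Nat.mod_lt _ (by norm_num))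

/-- `ε_d⁻¹` to an odd power: `(ε_d⁻¹)^{2k+1} = χ₋₄(d)^k·ε_d⁻¹` with `χ₋₄(d) = −1` iff `d ≡ 3 (mod 4)` (tree: `thetaEps_inv_sq`).
[cite: Shimura1973HalfIntegral, §1] -/
theorem thetaEps_inv_pow_two_mul_add_one (d : ℤ) (k : ℕ) :
    (thetaEps d)⁻¹ ^ (2 * k + 1) = (if d % 4 = 3 then (-1 : ℂ) else 1) ^ k * (thetaEps d)⁻¹ := by
  rw [pow_succ, pow_mul, thetaEps_inv_sq]

/-- **The Jacobi symbol of the θ-multiplier at `γ_j = [[8a + jM′, ·],[8M′, d_j]]`**: for odd `M′`, odd `d ≡ 8 (mod M′)`,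
`J(8M′ | d) = (−1)^{[M′ ≡ 3 ≡ d (4)]}·J(2 | M′)·J(2 | d)` (quadratic reciprocity and `J(d | M′) = J(8 | M′) = J(2 | M′)`, the tree's `Tunnell1983.jacobiSym_eight`).
[cite: IrelandRosen1990, Ch. 5 §2 Prop. 5.2.2 (Jacobi reciprocity)] -/
theorem jacobiSym_eight_mul_left {M d : ℕ} (hM : Odd M) (hd : Odd d) (hdM : (d : ℤ) % M = 8 % M) :
    J(8 * M | d) = (if M % 4 = 3 ∧ d % 4 = 3 then -1 else 1) * J(2 | M) * J(2 | d) := by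
  have hdM' : J(d | M) = J(2 | M) := by
    rw [jacobiSym.mod_left (d : ℤ) M, hdM, ← jacobiSym.mod_left, Tunnell1983.jacobiSym_eight hM]
  rw [jacobiSym.mul_left, Tunnell1983.jacobiSym_eight hd,
    ← jacobiSym.quadratic_reciprocity_if (Nat.odd_iff.mp hM) (Nat.odd_iff.mp hd), hdM']
  split_ifs <;> ring

/-- The representatives `d_j = 8 + M′j`: `d_j ≡ 8 (mod M′)` and `d_j ≡ M′j (mod 8)`; `d_j` is odd for odd `M′, j`. [folklore] -/
theorem flipRung_dj_congr (M j : ℕ) (hM : Odd M) (hj : Odd j) :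
    ((8 + M * j : ℕ) : ℤ) % M = 8 % M ∧ (8 + M * j) % 8 = M * j % 8 ∧ Odd (8 + M * j) := by
  refine ⟨?_, by omega, ?_⟩
  · push_cast
    rw [Int.add_mul_emod_self_left]
  · exact Even.add_odd (by decide) (Nat.odd_mul.mpr ⟨hM, hj⟩)

end Summit.BirchSwinnertonDyer.BirchSwinnertonDyer.Theorems.PrintCFram.FlipRung

end
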